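import Summits.MatrixMultiplication.OmegaCensus.STPPVosperSlackFourCell22SoundTools
import Summits.MatrixMultiplication.OmegaCensus.STPPVosperSlackTwoCheckersSound

/-!
# ω-census (abelian STPP census): cell (2,2) of the slack-4 law — masks as subsets of `ZMod p` (kernel tool)

HONEST FRAMING (pub-omega census; verbatim): lottery ticket; floor = certified bounds/negative ranges.
Census STRUCTURE (seat pub-omega-stpp-2 gen 28, 2026-08-29), family (b2).  The bridge between the bit masks of `STPPVosperSlackFourCell22Checker.lean`
and finite subsets of `ZMod p`, for the cell-(2,2) reduction (`STPPVosperSlackFourCell22Reduce.lean`): `setOfMask p M = {v : tb M v.val}` and its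
behaviour under `maskOf` of a value list, `sumMask` (sumset with a value list), `affMask` (affine image), `rot` (translation), `normMask` (a translation),
`dilRunsMask` (dilation), plus value bookkeeping (`val_neg_natCast`).  UNCONDITIONAL; no `decide`.  Nothing here is progress on `ω`.

References: H. S. Warren, Hacker's Delight (2002), §2-1 (bit sets); H. Cohn, R. Kleinberg, B. Szegedy, C. Umans, FOCS 2005, Def. 5.1 (the use).
-/

open Finset
open scoped Pointwise

namespace Summit.MatrixMultiplication.OmegaCensus.CubeNB.S2

open Summit.MatrixMultiplication.OmegaCensus.CubeNB.Bits

variable {p : ℕ} [hp : Fact p.Prime]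

/-- The subset of `ZMod p` encoded by a mask. [folklore] -/
def setOfMask (p : ℕ) [NeZero p] (M : ℕ) : Finset (ZMod p) := univ.filter fun v => tb M v.val = true

/-- Membership in `setOfMask`. [folklore] -/
theorem mem_setOfMask {M : ℕ} {v : ZMod p} : v ∈ setOfMask p M ↔ tb M v.val = true := by
  unfold setOfMask; rw [mem_filter]; exact ⟨fun h => h.2, fun h => ⟨mem_univ _, h⟩⟩

/-- The value-membership spec of `setOfMask` (for a mask below `2^p`). [folklore] -/
theorem tb_iff_setOfMask {M : ℕ} (hM : M < 2 ^ p) (v : ℕ) : tb M v = true ↔ ∃ e ∈ setOfMask p M, e.val = v := by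
  constructor
  · intro h
    have hv : v < p := by
      by_contra hv'; rw [tb_eq_false_of_lt hM (not_lt.1 hv')] at h; exact Bool.noConfusion h
    exact ⟨(v : ZMod p), mem_setOfMask.2 (by rwa [ZMod.val_cast_of_lt hv]), ZMod.val_cast_of_lt hv⟩
  · rintro ⟨e, he, rfl⟩; exact mem_setOfMask.1 he

/-- `setOfMask` of the mask of the sorted value list of `Y` is `Y`. [folklore] -/
theorem setOfMask_maskOf_sort (Y : Finset (ZMod p)) : setOfMask p (maskOf ((Y.image ZMod.val).sort (· ≤ ·))) = Y := by
  ext v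
  rw [mem_setOfMask, tb_maskOf, (valList_spec Y).1]
  constructor
  · rintro ⟨b, hb, hbv⟩; rwa [← ZMod.val_injective p hbv]
  · intro hv; exact ⟨v, hv, rfl⟩

/-- A mask of values below `p` from a value-membership spec. [folklore] -/
theorem setOfMask_eq_of_spec {M : ℕ} {Y : Finset (ZMod p)} (h : ∀ v, tb M v = true ↔ ∃ e ∈ Y, e.val = v) : setOfMask p M = Y := by
  ext v
  rw [mem_setOfMask, h]
  constructor
  · rintro ⟨e, he, hev⟩; rwa [← ZMod.val_injective p hev]
  · intro hv; exact ⟨v, hv, rfl⟩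

/-- **Translation**: `setOfMask (rot p M q) = setOfMask M + q`. [folklore] -/
theorem setOfMask_rot {M q : ℕ} (hM : M < 2 ^ p) (hq : q ≤ p) :
    setOfMask p (rot p M q) = (setOfMask p M).image fun v => v + (q : ZMod p) := by
  have hp0 : 0 < p := hp.out.pos
  ext v
  rw [mem_setOfMask, tb_rot hM hq v.val_lt, mem_image]
  constructor
  · intro h
    refine ⟨v - (q : ZMod p), mem_setOfMask.2 ?_, by ring⟩
    have hc := cast_add_sub_mod (p := p) (u := v.val) (v := q) (by omega)
    have hval : (v - (q : ZMod p)).val = (v.val + p - q) % p := by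
      have := congrArg ZMod.val hc
      rw [ZMod.val_natCast, Nat.mod_eq_of_lt (Nat.mod_lt _ hp0), ZMod.natCast_zmod_val] at this
      exact this.symm
    rwa [hval]
  · rintro ⟨w, hw, rfl⟩
    have hw' := mem_setOfMask.1 hw
    have hc := cast_add_sub_mod (p := p) (u := (w + (q : ZMod p)).val) (v := q) (by omega)
    rw [ZMod.natCast_zmod_val, add_sub_cancel_right] at hc
    have := congrArg ZMod.val hc
    rw [ZMod.val_natCast, Nat.mod_eq_of_lt (Nat.mod_lt _ hp0)] at this
    rwa [this]

/-- **Sumset with a value list**: `setOfMask (sumMask p X M) = X + setOfMask M` (`X` as residues). [folklore] -/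
theorem setOfMask_sumMask {X : List ℕ} {M : ℕ} (hX : ∀ x ∈ X, x < p) (hM : M < 2 ^ p) :
    setOfMask p (sumMask p X M) = (X.map fun x : ℕ => (x : ZMod p)).toFinset + setOfMask p M := by
  ext v
  unfold sumMask
  rw [mem_setOfMask, tb_foldl_lor_fun, Finset.mem_add]
  constructor
  · rintro (h | ⟨x, hx, h⟩)
    · rw [tb_eq_testBit, Nat.zero_testBit] at h; exact absurd h Bool.false_ne_true
    · have hx' := hX x hx
      have hrot : rot p M x = rot p M x := rfl
      have hmem : v ∈ setOfMask p (rot p M x) := mem_setOfMask.2 h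
      rw [setOfMask_rot hM hx'.le, mem_image] at hmem
      obtain ⟨w, hw, rfl⟩ := hmem
      exact ⟨(x : ZMod p), List.mem_toFinset.2 (List.mem_map.2 ⟨x, hx, rfl⟩), w, hw, add_comm _ _⟩
  · rintro ⟨a, ha, w, hw, rfl⟩
    obtain ⟨x, hx, rfl⟩ := List.mem_map.1 (List.mem_toFinset.1 ha)
    refine Or.inr ⟨x, hx, ?_⟩
    have hmem : w + (x : ZMod p) ∈ setOfMask p (rot p M x) := by
      rw [setOfMask_rot hM (hX x hx).le, mem_image]; exact ⟨w, hw, rfl⟩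
    rw [add_comm]; exact mem_setOfMask.1 hmem

omit hp in
/-- Meaning of `affMask`: bit `w` is set iff `w = (μ·v + c) mod p` for a member `v < p` of `M`. [folklore] -/
theorem tb_affMask {μ c M w : ℕ} : tb (affMask p μ c M) w = true ↔ ∃ v, v < p ∧ tb M v = true ∧ (μ * v + c) % p = w := by
  unfold affMask
  rw [tb_maskOf, List.mem_map]
  constructor
  · rintro ⟨v, hv, rfl⟩
    obtain ⟨hvr, htb⟩ := mem_members.1 hv
    exact ⟨v, List.mem_range.1 hvr, htb, rfl⟩
  · rintro ⟨v, hv, htb, rfl⟩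
    exact ⟨v, mem_members.2 ⟨List.mem_range.2 hv, htb⟩, rfl⟩

/-- `affMask p μ c M < 2^p`. [folklore] -/
theorem affMask_lt (μ c M : ℕ) : affMask p μ c M < 2 ^ p :=
  lt_two_pow_of_tb fun w hw => by obtain ⟨v, _, _, rfl⟩ := tb_affMask.1 hw; exact Nat.mod_lt _ hp.out.pos

/-- **Affine image**: `setOfMask (affMask p μ c M) = (μ·v + c)-image of setOfMask M`. [folklore] -/
theorem setOfMask_affMask {μ c M : ℕ} :
    setOfMask p (affMask p μ c M) = (setOfMask p M).image fun v => (μ : ZMod p) * v + (c : ZMod p) := by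
  ext w
  rw [mem_setOfMask, tb_affMask, mem_image]
  constructor
  · rintro ⟨v, hv, htb, hw⟩
    refine ⟨(v : ZMod p), mem_setOfMask.2 (by rwa [ZMod.val_cast_of_lt hv]), ?_⟩
    apply ZMod.val_injective p
    rw [← hw, ← Nat.cast_mul, ← Nat.cast_add, ZMod.val_natCast]
  · rintro ⟨v, hv, rfl⟩
    refine ⟨v.val, v.val_lt, mem_setOfMask.1 hv, ?_⟩
    rw [← ZMod.val_natCast, Nat.cast_add, Nat.cast_mul, ZMod.natCast_zmod_val]

omit hp in
/-- The minimising rotation index is `< p` (for `0 < p`). [folklore] -/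
theorem normRot_lt (hp0 : 0 < p) (M : ℕ) : normRot p M < p := by
  unfold normRot
  suffices h : ∀ (l : List ℕ) (b : ℕ), b < p → (∀ t ∈ l, t < p) →
      l.foldl (fun b t => if rot p M t < rot p M b then t else b) b < p from
    h _ 0 hp0 fun t ht => List.mem_range.1 ht
  intro l
  induction l with
  | nil => intro b hb _; exact hb
  | cons t l ih =>
    intro b hb hl
    rw [List.foldl_cons]
    refine ih _ ?_ fun t' ht' => hl t' (List.mem_cons_of_mem _ ht')
    split
    · exact hl t (List.mem_cons.2 (Or.inl rfl))
    · exact hb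

/-- **The rotation normal form is a translate**: `setOfMask (normMask p M) = setOfMask M + t` with `t = normRot p M`. [folklore] -/
theorem setOfMask_normMask {M : ℕ} (hM : M < 2 ^ p) :
    setOfMask p (normMask p M) = (setOfMask p M).image fun v => v + ((normRot p M : ℕ) : ZMod p) := by
  unfold normMask; exact setOfMask_rot hM (normRot_lt hp.out.pos M).le

omit hp in
/-- `normMask p M < 2^p`. [folklore] -/
theorem normMask_lt (M : ℕ) : normMask p M < 2 ^ p := by unfold normMask; exact rot_lt_two_pow p M _

/-- **Dilation of a run mask**: `setOfMask (dilRunsMask p u rs) = u • setOfMask (dilRunsMask p 1 rs)`. [folklore] -/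
theorem setOfMask_dilRunsMask (u : ℕ) (rs : List (ℕ × ℕ)) :
    setOfMask p (dilRunsMask p u rs) = (setOfMask p (dilRunsMask p 1 rs)).image fun v => (u : ZMod p) * v := by
  ext w
  rw [mem_setOfMask, tb_dilRunsMask, mem_image]
  constructor
  · rintro ⟨r, hr, j, hj, hw⟩
    refine ⟨((r.1 + j : ℕ) : ZMod p), mem_setOfMask.2 (tb_dilRunsMask.2 ⟨r, hr, j, hj, by rw [one_mul, ZMod.val_natCast]⟩), ?_⟩
    apply ZMod.val_injective p
    rw [← hw, ← Nat.cast_mul, ZMod.val_natCast]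
  · rintro ⟨v, hv, rfl⟩
    obtain ⟨r, hr, j, hj, hv'⟩ := tb_dilRunsMask.1 (mem_setOfMask.1 hv)
    refine ⟨r, hr, j, hj, ?_⟩
    rw [one_mul] at hv'
    have : v = ((r.1 + j : ℕ) : ZMod p) := by
      apply ZMod.val_injective p; rw [← hv', ZMod.val_natCast]
    rw [this, ← Nat.cast_mul, ZMod.val_natCast]

/-- Value of `−(u : ZMod p)`. [folklore] -/
theorem val_neg_natCast (u : ℕ) : (-((u : ℕ) : ZMod p)).val = (p - u % p) % p := by
  have hp0 : 0 < p := hp.out.pos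
  rw [ZMod.neg_val, ZMod.val_natCast]
  split_ifs with h
  · have h0 : u % p = 0 := by rw [← ZMod.val_natCast, h, ZMod.val_zero]
    rw [h0, Nat.sub_zero, Nat.mod_self]
  · have h0 : u % p ≠ 0 := fun h0 => h (by
      rw [← ZMod.natCast_mod, h0, Nat.cast_zero])
    exact (Nat.mod_eq_of_lt (by omega : p - u % p < p)).symm

omit hp in
/-- Value list of a 3-element set `{a, b, c}`. [folklore] -/
theorem valSpec_three (a b c : ZMod p) : ∀ v, v ∈ [a.val, b.val, c.val] ↔ ∃ x ∈ ({a, b, c} : Finset (ZMod p)), x.val = v := by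
  intro v
  simp only [List.mem_cons, List.not_mem_nil, or_false, mem_insert, mem_singleton]
  constructor
  · rintro (rfl | rfl | rfl)
    · exact ⟨a, Or.inl rfl, rfl⟩
    · exact ⟨b, Or.inr (Or.inl rfl), rfl⟩
    · exact ⟨c, Or.inr (Or.inr rfl), rfl⟩
  · rintro ⟨x, (rfl | rfl | rfl), rfl⟩
    · exact Or.inl rfl
    · exact Or.inr (Or.inl rfl)
    · exact Or.inr (Or.inr rfl)

end Summit.MatrixMultiplication.OmegaCensus.CubeNB.S2
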